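import Summits.QuantumFields.YangMills.Theorems.ParabolicTrajectoryContinuumLimitOnTrajectoryJCGStubLevelSetTransport
import Summits.QuantumFields.YangMills.Theorems.ParabolicTrajectoryContinuumLimitOnTrajectoryJCGGlue
import Summits.QuantumFields.YangMills.Theorems.ParabolicTrajectoryContinuumLimitOnTrajectoryStubOSLegsD_Assembly

/-!
# Line `jacobian-collapse-gronwall` — skeleton v4 for crux `ContinuumLimitOnTrajectory` (stmt-QuantumFields-10522)

Crux = conjunct (A) of route `ParabolicTrajectory` (rev 4), concluded BY NAME below
(`Summit.QuantumFields.YangMills.Theses.ParabolicTrajectory.ContinuumLimitOnTrajectory`).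

Lead seat `prover-line-stmt-QuantumFields-10522-c1-0` (2026-08-16; a concurrent seat `…-10522-1` drives line
`curtiss-flowed-free-energies`). v1 = the planner's `Lines/jacobian_collapse_gronwall.lean`
(`planner-cruxplan-stmt-QuantumFields-10522-jacobian-collapse-gr-0`, 6 stubs + proved `CauchyBookkeeping`). v2 = the lead's RESHAPE
onto the LANDED vocabulary of line `two-orbit-synchronisation` (`Theorems/ParabolicTrajectoryContinuumLimitOnTrajectoryDefs{,B}.lean`,
packaging theorem `oneFieldOSLegs'` in `…StubOSLegsD_Assembly`, p90720):

* the planner's `stub_osReconstruction` (E2 from EXACT Wilson RP, E1 from lattice translations — both holes for the time-chiral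
  corner density, two-orbit wave 1) is no longer a stub: the packaging is the imported theorem `oneFieldOSLegs'`
  (`ConvProducts → UVB → AsympEuclid → ARP → UCL → ND2 → ND3 → ∃ T, IsYangMillsFor r (canon r sch) T ∧ …`);
* the planner's legs `stub_aPrioriBounds`, `stub_skewness` and (d3)/(d4) of `stub_infraredBridge` become LITERALLY the shared
  registered open stubs `stub_uvRegularity : UVRegularity` (`UVB ∧ AsympEuclid ∧ ARP ∧ ND2 ∧ ND3`) and
  `stub_clustering : ClusteringLeg` (`UCL`) of lines two-orbit / curtiss (one proof serves three lines);
* what is specific to THIS line is isolated in three stubs: the ENGINE `stub_jacobianCollapse : JacobianCollapse` (verbatim),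
  the pure-analysis `stub_levelSetTransport : LevelSetTransport` (verbatim), and `stub_smearedBridge : SmearedBridge`
  (= (d1)+(d2) of the old `InfraredBridge`: smeared tuning/brancher limits with `0 < Θ ≤ C_φ θ` and finite-size insensitivity AT
  the sequence points — where `θ > 0` and (ii) are consumed);
* glue PROVED: `cauchyBookkeeping_holds` (planner, verbatim, here), `curvMoment_eq_curvNPoint` (this line's centred canonical
  moments ARE two-orbit's `curvNPoint` at the sequence points) and `convProducts_of_cauchy` (landed in `…JCGDefs`).

Registered stubs (5): `stub_jacobianCollapse` (XL, engine, lead), `stub_levelSetTransport` ✓ (LANDED by wave 1: p100723, helper chart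
p98960; imported here), `stub_smearedBridge` (IR/regularity, open), `stub_uvRegularity`, `stub_clustering` (shared). Composition
`stubsImplyCrux : JacobianCollapse → LevelSetTransport → CauchyBookkeeping → SmearedBridge → UVRegularity → ClusteringLeg →
OneFieldOSLegs' → ContinuumLimitOnTrajectory` is sorry-free; `ContinuumLimitOnTrajectory_of` is the crux by name.
v4 IMPORTS the landed vocabulary `Theorems/ParabolicTrajectoryContinuumLimitOnTrajectoryJCGDefs.lean` (p97137: §1–§3 + the bridging glue
`curvMoment_eq_curvNPoint`, `convProducts_of_cauchy`), the landed stub B, and the landed glue `…JCGGlue` (p102436: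
`cauchyBookkeeping_holds` etc.); 4 sorries = the 4 open stubs; helpers toward the engine: `…JCGSmoothness` (`contDiffOn_timeSmeared`,
`CollapseOn.smooth_N` unconditionally, over Literature `WilsonCouplingSmoothness` p103801).

Disproof used (`Cruxes/ContinuumLimitOnTrajectory/Disproof.lean`, cdisprove gen 3, RESISTS; no `-- Targets` on line stubs yet):
the load-bearing pair {`β_k → ∞`, `θ > 0`} (`Negative.continuumLimitOnTrajectory_false_without_AF`) enters at region entry
(`B ≤ β_k`, `hBk` in `stubsImplyCrux`) and in `stub_smearedBridge` (`Θ > 0`) / `ND2` inside `UVRegularity`; §8 proves the ultralocal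
witness has `N^φ ≡ 0` (`timeSmeared_zero_coupling`), so it never enters the scaling region. §4 witness rigidity respected
(`c_k = a_k⁻⁴`, `canon`); §5/§7/§8 necessary conditions II–IV are implied by `ConvProducts`/`AsympEuclid`, IV′ is `¬ ND3`.
-/

open scoped SchwartzMap
open MeasureTheory Filter Topology
open Literature.MathematicalPhysics.QuantumFieldTheory Literature.MathematicalPhysics.QuantumLattice
open Literature.MathematicalPhysics.AQFT (IsOffDiagonal)
open Literature.Probability.LatticeModels (box)
open Summit.QuantumFields.YangMills.Theses.ParabolicTrajectory
open Summit.QuantumFields.YangMills.Theorems.LatticeGapOnTrajectory.Negative (tendsto_n_of_shape)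
open Summit.QuantumFields.YangMills.Cruxes.ContinuumLimitOnTrajectory.TwoOrbitSynchronisation
  (canon curvNPoint ConvProducts UVB AsympEuclid ARP UCL ND2 ND3 UVRegularity ClusteringLeg OneFieldOSLegs' oneFieldOSLegs'
    canon_a' canon_β' canon_L' canon_m canon_c_curvature)

noncomputable section

namespace Summit.QuantumFields.YangMills.Cruxes.ContinuumLimitOnTrajectory.JacobianCollapseGronwall

local notation "E⁴" => EuclideanSpace ℝ (Fin 4)

/-! ## §4 The registered stubs of v4 (`sorry` lives only in these four theorems; `stub_levelSetTransport` is the LANDED theorem of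
`…JCGStubLevelSetTransport` (p100723, imported); statement C is proved in §5; vocabulary = `…JCGDefs` (p97137, imported)) -/

/-- **STUB A · `stub_jacobianCollapse`** (= `JacobianCollapse` verbatim; load-bearing, hardest, lead-held). -/
theorem stub_jacobianCollapse : JacobianCollapse := by
  sorry

/-- **STUB D′ · `stub_smearedBridge`** (= `SmearedBridge`; jacobian-specific IR/regularity inputs (d1)+(d2); open). -/
theorem stub_smearedBridge : SmearedBridge := by
  sorry

/-- **STUB E′ · `stub_uvRegularity`** (= two-orbit's registered `UVRegularity`, shared with lines two-orbit / curtiss; UV, open). -/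
theorem stub_uvRegularity : UVRegularity := by
  sorry

/-- **STUB F′ · `stub_clustering`** (= two-orbit's registered `ClusteringLeg`, shared; IR, open). -/
theorem stub_clustering : ClusteringLeg := by
  sorry

/-! ## §5 Proved glue — LANDED: `cauchyBookkeeping_holds`, `exists_isProfile`, `IsProfile.halve`, `log_decade`,
`timeSmeared_zero_coupling`, `not_tendsto_timeSmeared_ultralocal` are the theorems of `…JCGGlue` (p102436, imported). -/

/-! ## §6 The composition: the seven statements imply the crux, BY NAME (kernel-checked; no `sorry` below) -/

/-- The statement "the five stub statements, the proved bookkeeping and the landed packaging imply the crux" (v2). -/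
def StubsImplyCrux : Prop :=
  JacobianCollapse → LevelSetTransport → CauchyBookkeeping → SmearedBridge → UVRegularity → ClusteringLeg →
    OneFieldOSLegs' → ContinuumLimitOnTrajectory

/-- **The glue of the line.**  Fix a profile `φ` and its halving `ψ`; stub D (for `φ` and `ψ`) gives the limits
`Θ ∈ (0, C_φ θ]` of the tuning observable and `Rinf > 0` of the brancher along the given sequence and finite-size
insensitivity; stub A (with `M₀ := M₀^A`,
`θ₀ := θ₀^A/(2C_φ)`) gives the ratio gap, whence `Rinf ≤ (σ/2)Θ ∨ 4σΘ ≤ Rinf`, and the collapse package on the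
branch-pure windows `(2Θ/3, 4Θ/3) × (7Rinf/8, 9Rinf/8)`; stub B turns it into per-decade upward transport + same-level
Lipschitz, stub C into Cauchy convergence of every observable along the sequence (entry: `n_k → ∞`,
`ℓMⁿₖ⁺¹ ≤ L_k` from `a_k L_k → ∞`, `β_k ≥ B` from `β_k → ∞`); `curvMoment_eq_curvNPoint` reads the limits as `ConvProducts`;
`UVRegularity`, `ClusteringLeg` supply the OS inputs; the landed `oneFieldOSLegs'` format assembles the OS data for `canon r sch`. -/
theorem stubsImplyCrux : StubsImplyCrux := by
  intro hA hB hC hD hE hF hG G _ _ _ _ hGrp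
  letI : MeasurableSpace G := borel G
  haveI : BorelSpace G := ⟨rfl⟩
  intro r
  obtain ⟨φ, hφ⟩ := exists_isProfile
  have hψ : IsProfile (fun u => φ (u / 2)) := hφ.halve
  obtain ⟨Cφ, hCφ, hDφ⟩ := hD G hGrp r φ hφ
  obtain ⟨Cψ, -, hDψ⟩ := hD G hGrp r (fun u => φ (u / 2)) hψ
  obtain ⟨M₀, hM₀⟩ := hA G hGrp r φ hφ
  refine ⟨M₀, fun M hMM₀ hM2 => ?_⟩
  obtain ⟨θA, σ, B, n₀, ℓ, hθA, hσ, hgap, hwin⟩ := hM₀ M hMM₀ hM2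
  refine ⟨θA / (2 * Cφ), by positivity, ?_⟩
  intro θ Δ sch n hθ hθlt hΔ hshape hβ hconv htune hmass
  -- stub D′: smeared limits along the sequence and finite-size insensitivity at the sequence points
  obtain ⟨⟨Θ, hΘpos, hΘle, hNΘ⟩, hfsN, hfsX⟩ :=
    hDφ M θ Δ sch n hM2 hθ hΔ hshape hβ hconv htune hmass
  obtain ⟨⟨R, hRpos, -, hNR⟩, hfsR, -⟩ :=
    hDψ M θ Δ sch n hM2 hθ hΔ hshape hβ hconv htune hmass
  have hΘlt : Θ < θA / 2 := by
    calc Θ ≤ Cφ * θ := hΘle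
      _ < Cφ * (θA / (2 * Cφ)) := mul_lt_mul_of_pos_left hθlt hCφ
      _ = θA / 2 := by field_simp
  have hΘA : Θ < θA := by linarith
  -- entry into the scaling region along the sequence
  have hM1 : 1 ≤ M := by omega
  have hMpos : (0 : ℝ) < M := by exact_mod_cast (by omega : 0 < M)
  have hM1r : (1 : ℝ) ≤ M := by exact_mod_cast hM1
  have hn : Tendsto n atTop atTop := tendsto_n_of_shape sch hshape
  have hn₀ : ∀ᶠ k in atTop, n₀ ≤ n k := hn.eventually_ge_atTop n₀
  have hvol : ∀ᶠ k in atTop, ℓ * M ^ (n k + 1) ≤ sch.L k := by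
    filter_upwards [Summit.QuantumFields.YangMills.Theorems.ContinuumLimitOnTrajectory.Negative.eventually_mul_le_L
      hM1 sch n hshape (ℓ * M)] with k hk
    calc ℓ * M ^ (n k + 1) = ℓ * M * M ^ n k := by ring
      _ ≤ sch.L k := hk
  have hBk : ∀ᶠ k in atTop, B ≤ sch.β k := hβ.eventually_ge_atTop B
  -- the brancher along the sequence, by name
  have hRseq : Tendsto (fun k => obsFun r φ (sch.L k) ObsIx.brancher ((M : ℝ) ^ n k) (sch.β k))
      atTop (𝓝 R) := hNR
  -- ratio gap in the limit
  have hratio : R ≤ σ / 2 * Θ ∨ 4 * σ * Θ ≤ R := by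
    by_contra hcon
    push Not at hcon
    have hev : ∀ᶠ k in atTop,
        obsFun r φ (sch.L k) ObsIx.brancher ((M : ℝ) ^ n k) (sch.β k) ≤
            σ / 2 * timeSmeared r φ (sch.L k) ((M : ℝ) ^ n k) (sch.β k) ∨
          4 * σ * timeSmeared r φ (sch.L k) ((M : ℝ) ^ n k) (sch.β k) ≤
            obsFun r φ (sch.L k) ObsIx.brancher ((M : ℝ) ^ n k) (sch.β k) := by
      filter_upwards [hn₀, hvol, hBk, hNΘ.eventually (Ioo_mem_nhds hΘpos hΘA)] with k hk1 hk2 hk3 hk4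
      exact hgap (n k) (sch.L k) hk1 hk2 _ _
        ⟨le_rfl, pow_le_pow_right₀ hM1r (Nat.le_succ _)⟩ hk3 hk4
    have h1 : ∀ᶠ k in atTop, σ / 2 * timeSmeared r φ (sch.L k) ((M : ℝ) ^ n k) (sch.β k) <
        obsFun r φ (sch.L k) ObsIx.brancher ((M : ℝ) ^ n k) (sch.β k) := by
      have hlim := hRseq.sub (hNΘ.const_mul (σ / 2))
      have hpos : (0 : ℝ) < R - σ / 2 * Θ := by linarith [hcon.1]
      filter_upwards [Filter.Tendsto.eventually_const_lt hpos hlim] with k hk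
      linarith
    have h2 : ∀ᶠ k in atTop, obsFun r φ (sch.L k) ObsIx.brancher ((M : ℝ) ^ n k) (sch.β k) <
        4 * σ * timeSmeared r φ (sch.L k) ((M : ℝ) ^ n k) (sch.β k) := by
      have hlim := (hNΘ.const_mul (4 * σ)).sub hRseq
      have hpos : (0 : ℝ) < 4 * σ * Θ - R := by linarith [hcon.2]
      filter_upwards [Filter.Tendsto.eventually_const_lt hpos hlim] with k hk
      linarith
    obtain ⟨k, hk, hk1, hk2⟩ := (hev.and (h1.and h2)).exists
    rcases hk with hk | hk <;> linarith
  -- the branch-pure windows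
  set θ₁ : ℝ := 2 * Θ / 3 with hθ₁
  set θ₂ : ℝ := 4 * Θ / 3 with hθ₂
  set ρ₁ : ℝ := 7 * R / 8 with hρ₁
  set ρ₂ : ℝ := 9 * R / 8 with hρ₂
  have hpure : 2 * σ * θ₂ ≤ ρ₁ ∨ ρ₂ ≤ σ * θ₁ := by
    rcases hratio with h | h
    · right; rw [hρ₂, hθ₁]; nlinarith
    · left; rw [hρ₁, hθ₂]; nlinarith
  obtain ⟨η, K, Lip, hη0, hηs, hLip0, hpack⟩ :=
    hwin θ₁ θ₂ ρ₁ ρ₂ (by positivity) (by rw [hθ₁, hθ₂]; linarith) (by rw [hθ₂]; linarith)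
      (by positivity) (by rw [hρ₁, hρ₂]; linarith) hpure
  -- stub B: per-decade transport + same-level Lipschitz, at every admissible (n, L)
  have hT : ∀ (n' L : ℕ), n₀ ≤ n' → ℓ * M ^ (n' + 1) ≤ L →
      (∀ β₀ : ℝ, (((M : ℝ) ^ n'), β₀) ∈ scalingWindow (timeSmeared r φ L) (obsFun r φ L ObsIx.brancher)
            B θ₁ θ₂ ρ₁ ρ₂ →
          obsFun r φ L ObsIx.brancher ((M : ℝ) ^ n') β₀ ∈
              Set.Ioo (ρ₁ + η ObsIx.brancher n' * Real.log M) (ρ₂ - η ObsIx.brancher n' * Real.log M) →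
          ∃ β₁ : ℝ, β₀ ≤ β₁ ∧
            timeSmeared r φ L ((M : ℝ) ^ (n' + 1)) β₁ = timeSmeared r φ L ((M : ℝ) ^ n') β₀ ∧
            ∀ i, |obsFun r φ L i ((M : ℝ) ^ (n' + 1)) β₁ - obsFun r φ L i ((M : ℝ) ^ n') β₀| ≤
              η i n' * Real.log M) ∧
      (∀ D ∈ Set.Icc ((M : ℝ) ^ n') ((M : ℝ) ^ (n' + 1)),
        ({b : ℝ | (D, b) ∈ scalingWindow (timeSmeared r φ L) (obsFun r φ L ObsIx.brancher)
            B θ₁ θ₂ ρ₁ ρ₂}).OrdConnected →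
        ∀ β β' : ℝ, (D, β) ∈ scalingWindow (timeSmeared r φ L) (obsFun r φ L ObsIx.brancher) B θ₁ θ₂ ρ₁ ρ₂ →
          (D, β') ∈ scalingWindow (timeSmeared r φ L) (obsFun r φ L ObsIx.brancher) B θ₁ θ₂ ρ₁ ρ₂ →
            ∀ i, |obsFun r φ L i D β - obsFun r φ L i D β'| ≤
              Lip i * |timeSmeared r φ L D β - timeSmeared r φ L D β'|) := by
    intro n' L hn' hL
    have h := hB ObsIx ObsIx.brancher (obsFun r φ L) (timeSmeared r φ L) B θ₁ θ₂ ρ₁ ρ₂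
      ((M : ℝ) ^ n') ((M : ℝ) ^ (n' + 1)) (K n') (fun i => η i n') Lip (pow_pos hMpos _)
      (pow_le_pow_right₀ hM1r (Nat.le_succ _)) (fun i => hη0 i n') hLip0 (hpack n' L hn' hL).1
    simp only [log_decade hM2] at h
    exact h
  -- stub C: Cauchy convergence of every observable along the sequence
  have hδ : 0 < R / 40 := by positivity
  have hCauchy : ∀ i, CauchySeq fun k => obsFun r φ (sch.L k) i ((M : ℝ) ^ n k) (sch.β k) := by
    refine hC ObsIx ObsIx.brancher (fun i n' L b => obsFun r φ L i ((M : ℝ) ^ n') b)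
      (fun n' L b => timeSmeared r φ L ((M : ℝ) ^ n') b) B θ₁ θ₂ ρ₁ ρ₂ (Real.log M) η Lip
      (fun n' => ℓ * M ^ (n' + 1)) n₀ (Real.log_nonneg hM1r) ?_ hη0 hηs hLip0 ?_ ?_ n sch.L sch.β Θ R
      (R / 40) hn hvol hBk hNΘ ⟨by rw [hθ₁]; linarith, by rw [hθ₂]; linarith⟩ hRseq hδ ?_ hfsN ?_
    · intro a b hab
      exact Nat.mul_le_mul_left ℓ (Nat.pow_le_pow_right (by omega) (by omega))
    · intro n' L hn' hL β₀ hβ₀ hR0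
      exact (hT n' L hn' hL).1 β₀ hβ₀ hR0
    · intro n' L hn' hL β hβ β' hβ' i
      exact (hT n' L hn' hL).2 ((M : ℝ) ^ n') ⟨le_rfl, pow_le_pow_right₀ hM1r (Nat.le_succ _)⟩
        ((hpack n' L hn' hL).2 ((M : ℝ) ^ n') ⟨le_rfl, pow_le_pow_right₀ hM1r (Nat.le_succ _)⟩)
        β β' hβ hβ' i
    · intro x hx
      rw [hρ₁, hρ₂]
      constructor <;> linarith [hx.1, hx.2]
    · intro i
      cases i with
      | brancher => exact hfsR
      | moment m f hf =>
        intro ε hε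
        filter_upwards [hfsX m f hf ε hε] with k hk S hS
        have := hk S hS
        rw [hshape k] at this
        simpa [obsFun_moment] using this
  -- (g1) convergence of every off-diagonal centred canonical curvature moment along `sch`, read as `curvNPoint`
  have hg1 : ∀ (m : ℕ) (f : Fin m → 𝓢(E⁴, ℝ)), IsOffDiagonal (tensorOf f) →
      ∃ c : ℝ, Tendsto (fun k => curvNPoint r sch k m f) atTop (𝓝 c) := by
    intro m f hf
    obtain ⟨c, hc⟩ := cauchySeq_tendsto_of_complete (hCauchy (ObsIx.moment m f hf))
    refine ⟨c, hc.congr fun k => ?_⟩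
    rw [← curvMoment_eq_curvNPoint r sch k m f, hshape k]
    rfl
  -- two-orbit vocabulary: full-sequence convergence on products, the shared UV/IR legs, the landed packaging
  have hconvP : ConvProducts r sch := fun p _ f hf => hg1 p f hf
  obtain ⟨hUVB, hE1, hARP, hND2, hND3⟩ := hE G hGrp r M θ Δ sch n hθ hΔ hshape hβ hconv htune hmass hconvP
  have hUCL : UCL r sch := hF G hGrp r M θ Δ sch n hθ hΔ hshape hβ hconv htune hmass hconvP hUVB
  obtain ⟨T, hYM, hNT, hNG⟩ := hG G r sch hconvP hUVB hE1 hARP hUCL hND2 hND3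
  exact ⟨canon r sch, rfl, rfl, rfl, T, hYM, hNT, hNG⟩

/-! ## §7 The skeleton: the crux BY NAME from the registered stubs -/

/-- **`ContinuumLimitOnTrajectory_of`** — the crux (A) of route `ParabolicTrajectory`, from the five registered stubs, the proved
bookkeeping and the landed packaging theorem `oneFieldOSLegs'`. -/
theorem ContinuumLimitOnTrajectory_of : ContinuumLimitOnTrajectory :=
  stubsImplyCrux stub_jacobianCollapse stub_levelSetTransport cauchyBookkeeping_holds stub_smearedBridge
    stub_uvRegularity stub_clustering oneFieldOSLegs'


/-! ## §8 Checks against the landed Negative lemmas — LANDED in `…JCGGlue` (`timeSmeared_zero_coupling`,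
`not_tendsto_timeSmeared_ultralocal`: the ultralocal witness of `Negative.continuumLimitOnTrajectory_false_without_AF` never
enters the scaling region). -/

end Summit.QuantumFields.YangMills.Cruxes.ContinuumLimitOnTrajectory.JacobianCollapseGronwall

end
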